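import Summits.CriticalPhenomena.CardyFormulaZ2.Theorems.CardySelfRefinementLagHandOffHalfPlaneTwoArmUndocked
import Summits.CriticalPhenomena.CardyFormulaZ2.Theorems.CardySelfRefinementLagHandOffNoTouch
import HarnessLib

/-!
# No one-sided touching of a fixed vertical / horizontal line by the limit interface

Closes the registered stubs `stub_quadTransfer_noTouchRe` / `stub_quadTransfer_noTouchIm` of crux
stmt-CriticalPhenomena-10268 (line `hitting-tournament`): along positive meshes `δₙ → 0`, every
weak limit `ν` of the interface laws of a `ℤ²`-discretisation family of a Dobrushin domain is
carried by curve classes no representative of which touches a fixed vertical (resp. horizontal)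
line one-sidedly at an interior point of the domain while moving both before and after.  They are
the landed conditional forms `stub_quadTransfer_noTouchRe_of_threeArm` /
`stub_quadTransfer_noTouchIm_of_threeArm` (`…LagHandOffNoTouch`) fed with the now unconditional
undocked half-plane three-arm bound `stub_noTouch_undockedThreeArm` (`…HalfPlaneTwoArmUndocked`).

References: G. F. Lawler, O. Schramm, W. Werner, Electron. J. Probab. 7 (2002), App. A
[LawlerSchrammWernerEJP2002]; M. Aizenman, A. Burchard, Duke Math. J. 99 (1999), §2
[AizenmanBurchard1999].
-/

noncomputable section

open MeasureTheory Filter Set Topology Metric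
open scoped unitInterval BoundedContinuousFunction ENNReal
open Literature.Probability.Percolation Literature.Probability.LatticeModels
open Literature.Probability.RandomPlanarGeometry Literature.Probability.Percolation.QuadCrossing

namespace Summit.CriticalPhenomena.CardyFormulaZ2.Cruxes.LagHandOff.HittingTournament

/-- **No one-sided touching of a fixed vertical line** `{re = x₀}` by any representative of
`ν`-a.e. limit interface class at an interior point of the domain (registered stub; from the
undocked half-plane three-arm bound). [cite: LawlerSchrammWernerEJP2002, Appendix A] -/
theorem stub_quadTransfer_noTouchRe : ∀ (D : DobrushinDomain) (E : ℝ → DiscreteDobrushin), ZdDiscretisationFamily D E → ∀ δs : ℕ → ℝ, (∀ n, 0 < δs n) → Tendsto δs atTop (𝓝 0) → ∀ (ν : Measure (CurveClass ℂ)) [IsProbabilityMeasure ν], (∀ f : CurveClass ℂ →ᵇ ℝ, Tendsto (fun n => ∫ ω, f (bondInterfaceIn D (E (δs n)) ω) ∂(bondPercolation (zdGraph 2) half)) atTop (𝓝 (∫ γ, f γ ∂ν))) → ∀ x₀ : ℝ, ∀ᵐ γ ∂ν, ∀ c : Curve ℂ, CurveClass.mk c = γ → ∀ s u : I, s < u →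 ((∀ r ∈ Set.Icc s u, (c r).re ≤ x₀) ∨ (∀ r ∈ Set.Icc s u, x₀ ≤ (c r).re)) → ∀ t ∈ Set.Ioo s u, (c t).re = x₀ → c t ∈ D.carrier → (∀ r ∈ Set.Icc s t, c r = c t) ∨ (∀ r ∈ Set.Icc t u, c r = c t) :=
  stub_quadTransfer_noTouchRe_of_threeArm stub_noTouch_undockedThreeArm

/-- **No one-sided touching of a fixed horizontal line** `{im = y₀}` by any representative of
`ν`-a.e. limit interface class at an interior point of the domain (registered stub; from the
undocked half-plane three-arm bound). [cite: LawlerSchrammWernerEJP2002, Appendix A] -/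
theorem stub_quadTransfer_noTouchIm : ∀ (D : DobrushinDomain) (E : ℝ → DiscreteDobrushin), ZdDiscretisationFamily D E → ∀ δs : ℕ → ℝ, (∀ n, 0 < δs n) → Tendsto δs atTop (𝓝 0) → ∀ (ν : Measure (CurveClass ℂ)) [IsProbabilityMeasure ν], (∀ f : CurveClass ℂ →ᵇ ℝ, Tendsto (fun n => ∫ ω, f (bondInterfaceIn D (E (δs n)) ω) ∂(bondPercolation (zdGraph 2) half)) atTop (𝓝 (∫ γ, f γ ∂ν))) → ∀ y₀ : ℝ, ∀ᵐ γ ∂ν, ∀ c : Curve ℂ, CurveClass.mk c = γ → ∀ s u : I, s < u → ((∀ r ∈ Set.Icc s u, (c r).im ≤ y₀) ∨ (∀ r ∈ Set.Icc s u, y₀ ≤ (c r).im)) → ∀ t ∈ Set.Ioo s u, (c t).im = y₀ → c t ∈ D.carrier → (∀ r ∈ Set.Icc s t, c r = c t) ∨ (∀ r ∈ Set.Icc t u, c r = c t) :=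
  stub_quadTransfer_noTouchIm_of_threeArm stub_noTouch_undockedThreeArm

end Summit.CriticalPhenomena.CardyFormulaZ2.Cruxes.LagHandOff.HittingTournament
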